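import Summits.HubbardSuperconductivity.HubbardSuperconductivity.Theorems.AnisotropyChordKnnJacobi

/-!
# Route `AnisotropyChord` / H0 rotor rung: the K_{n,n} SIBLING of XY-LM₀ — the two-big-spin Jacobi block, TYPED
(VERBATIM port of theory seat `hubbard-h0-rotor-theory-1`'s `PartKnn.lean`, cycle 12; THEOREMS.md M12/M17; memo
ROTOR-THEORY-11 §163/§166; director ruling CYCLE 12 (B))

Two-big-spin reduction (THEOREMS M12, taken as the DEFINITION of the object, exactly as typed by the theory seat): on the
complete bipartite graph `K_{n,n}` (`n = twoS`, spin `s = n/2` per side) the sector-`M` ground state of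
`H = −S⃗_A·S⃗_B + η Sᶻ_A Sᶻ_B` (`η = 1 − Δ`) lives in the exchange-even block `J ∈ 𝒥_M = {J : |M| ≤ J ≤ 2s, J ≡ 2s (mod 2)}`,
where `const − H` is the Jacobi matrix `P_M(η)` = `knnBlock twoS M η`:
`p_J = ½J(J+1) + (η/4)(b²_{J−1} + b²_J)`, `q_{J,J+2} = (η/4) b_J b_{J+1}`, `b_J(M)² = ((J+1)² − M²) β_J²`,
`β_J² = ((2s+1)² − (J+1)²)/((2J+1)(2J+3))`.  `XYLiebMattisKnn twoS Δ` := «`⟨J(J+1)⟩` in the top vector of `P_M(1 − Δ)` is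
non-decreasing in `|M|`» — the solvable sibling of the open first lemma XY-LM₀ (`Tower.TotalSpinMonotone`).

This file: the verbatim defs (`betaSq`, `bSq`, `bSqPred`, `jMin`, `numLevels`, `levelJ`, `knnBlock`, `casimirMean`,
`XYLiebMattisKnn`; `IsTopVector` is in `…KnnJacobi`), their `ℕ`-indexed sequence form (`lev`, `pK`, `cK`, `fK`,
`knnBlock_eq_jac`, `casimirMean_eq`), level bookkeeping (`lev_top`, parity, the `M ↦ M+1` shift), positivity of the
couplings, and the monotone facts (F1) `betaSq` antitone, (F2)/(F4) `bSq` antitone in `|M|`.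
-/

set_option linter.dupNamespace false
set_option autoImplicit false

noncomputable section

open Finset Matrix

namespace Summit.HubbardSuperconductivity.HubbardSuperconductivity.Theorems.AnisotropyChord.Knn

/-! ## The typed object (verbatim port of PartKnn.lean) -/

/-- `β_J² = ((2s+1)² − (J+1)²)/((2J+1)(2J+3))`. [conjecture: theory seat hubbard-h0-rotor-theory-1, cycle 12 — typed object] -/
def betaSq (twoS J : ℕ) : ℝ :=
  (((twoS : ℝ) + 1) ^ 2 - ((J : ℝ) + 1) ^ 2) / ((2 * (J : ℝ) + 1) * (2 * (J : ℝ) + 3))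

/-- `b_J(M)² = ((J+1)² − M²) β_J²` (the `J ↔ J+1` reduced element of `Sᶻ_A − Sᶻ_B`), `0` beyond `J + 1 > 2s`.
[conjecture: theory seat hubbard-h0-rotor-theory-1, cycle 12 — typed object] -/
def bSq (twoS : ℕ) (M : ℤ) (J : ℕ) : ℝ :=
  if J + 1 ≤ twoS then (((J : ℝ) + 1) ^ 2 - (M : ℝ) ^ 2) * betaSq twoS J else 0

/-- `b²_{J−1}` with the convention `b_{−1} = 0`. [conjecture: theory seat hubbard-h0-rotor-theory-1, cycle 12 — typed object] -/
def bSqPred (twoS : ℕ) (M : ℤ) (J : ℕ) : ℝ := if J = 0 then 0 else bSq twoS M (J - 1)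

/-- lowest level of the exchange-even block: `|M|` or `|M| + 1`, matching the parity of `2s`.
[conjecture: theory seat hubbard-h0-rotor-theory-1, cycle 12 — typed object] -/
def jMin (twoS : ℕ) (M : ℤ) : ℕ := if M.natAbs % 2 = twoS % 2 then M.natAbs else M.natAbs + 1

/-- number of levels `|𝒥_M|` (for `|M| ≤ 2s`). [conjecture: theory seat hubbard-h0-rotor-theory-1, cycle 12 — typed object] -/
def numLevels (twoS : ℕ) (M : ℤ) : ℕ := (twoS - jMin twoS M) / 2 + 1

/-- the `k`-th level `J = jMin + 2k`. [conjecture: theory seat hubbard-h0-rotor-theory-1, cycle 12 — typed object] -/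
def levelJ (twoS : ℕ) (M : ℤ) (k : Fin (numLevels twoS M)) : ℕ := jMin twoS M + 2 * k.val

/-- **the two-big-spin Jacobi block `P_M(η)`** (THEOREMS M12).
[conjecture: theory seat hubbard-h0-rotor-theory-1, cycle 12 — typed object] -/
def knnBlock (twoS : ℕ) (M : ℤ) (η : ℝ) :
    Matrix (Fin (numLevels twoS M)) (Fin (numLevels twoS M)) ℝ :=
  fun k l =>
    if k = l then
      (levelJ twoS M k : ℝ) * ((levelJ twoS M k : ℝ) + 1) / 2
        + η / 4 * (bSqPred twoS M (levelJ twoS M k) + bSq twoS M (levelJ twoS M k))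
    else if l.val = k.val + 1 then
      η / 4 * Real.sqrt (bSq twoS M (levelJ twoS M k) * bSq twoS M (levelJ twoS M k + 1))
    else if k.val = l.val + 1 then
      η / 4 * Real.sqrt (bSq twoS M (levelJ twoS M l) * bSq twoS M (levelJ twoS M l + 1))
    else 0

/-- `⟨J(J+1)⟩` in the state `x`. [conjecture: theory seat hubbard-h0-rotor-theory-1, cycle 12 — typed object] -/
def casimirMean (twoS : ℕ) (M : ℤ) (x : Fin (numLevels twoS M) → ℝ) : ℝ :=
  (∑ k, (levelJ twoS M k : ℝ) * ((levelJ twoS M k : ℝ) + 1) * x k ^ 2) / ∑ k, x k ^ 2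

/-- **`XYLiebMattisKnn twoS Δ` — XY-Lieb–Mattis ordering on `K_{n,n}`, `n = twoS` (the solvable sibling of
XY-LM₀ / `TotalSpinMonotone Δ`):** for `|M| ≤ |M'| ≤ 2s`, `⟨S⃗²⟩` of the sector ground state is non-decreasing:
`g(M) ≤ g(M')`, with `g(M) = ⟨J(J+1)⟩` in the top eigenvector of `P_M(1 − Δ)`.
STATUS (theory seat): THEOREM Q (M13) and LEMMA R (M14) proved on paper; THEOREM Q⁺ (M20): all `n`, `Δ ∈ [0,1)` on paper with
exact machine certificates.  Lean (this seat): see `…KnnTopLinks`, `…KnnMLR`, `…KnnXYPoint`.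
[conjecture: theory seat hubbard-h0-rotor-theory-1, cycle 12 — decided instances, see memo §166] -/
def XYLiebMattisKnn (twoS : ℕ) (Δ : ℝ) : Prop :=
  ∀ (M M' : ℤ), |M| ≤ |M'| → M'.natAbs ≤ twoS →
    ∀ x x', IsTopVector (knnBlock twoS M (1 - Δ)) x → IsTopVector (knnBlock twoS M' (1 - Δ)) x' →
      casimirMean twoS M x ≤ casimirMean twoS M' x'

/-! ## `ℕ`-indexed sequence form -/

/-- level `J_k = jMin + 2k` as a function on `ℕ`. [folklore] -/
def lev (twoS : ℕ) (M : ℤ) (k : ℕ) : ℕ := jMin twoS M + 2 * k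

/-- diagonal `p_k(M) = ½J_k(J_k+1) + (η/4)(b²_{J_k−1} + b²_{J_k})`. [folklore] -/
def pK (twoS : ℕ) (M : ℤ) (η : ℝ) (k : ℕ) : ℝ :=
  (lev twoS M k : ℝ) * ((lev twoS M k : ℝ) + 1) / 2 + η / 4 * (bSqPred twoS M (lev twoS M k) + bSq twoS M (lev twoS M k))

/-- coupling `c_k(M) = (η/4) b_{J_k} b_{J_k + 1}` between the levels `k` and `k+1`. [folklore] -/
def cK (twoS : ℕ) (M : ℤ) (η : ℝ) (k : ℕ) : ℝ :=
  η / 4 * Real.sqrt (bSq twoS M (lev twoS M k) * bSq twoS M (lev twoS M k + 1))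

/-- the level function `J_k(J_k+1)`. [folklore] -/
def fK (twoS : ℕ) (M : ℤ) (k : ℕ) : ℝ := (lev twoS M k : ℝ) * ((lev twoS M k : ℝ) + 1)

/-- `levelJ = lev` on `Fin`. [folklore] -/
@[simp] theorem levelJ_eq_lev (twoS : ℕ) (M : ℤ) (k : Fin (numLevels twoS M)) :
    levelJ twoS M k = lev twoS M k := rfl

/-- **`knnBlock` is the Jacobi matrix `jac (numLevels) pK cK`.** [folklore] -/
theorem knnBlock_eq_jac (twoS : ℕ) (M : ℤ) (η : ℝ) :
    knnBlock twoS M η = jac (numLevels twoS M) (pK twoS M η) (cK twoS M η) := by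
  ext k l
  simp only [knnBlock, jac, levelJ_eq_lev, pK, cK]

/-- `casimirMean` in sequence form. [folklore] -/
theorem casimirMean_eq (twoS : ℕ) (M : ℤ) (x : Fin (numLevels twoS M) → ℝ) :
    casimirMean twoS M x
      = (∑ k ∈ range (numLevels twoS M), fK twoS M k * ext0 x k ^ 2)
          / ∑ k ∈ range (numLevels twoS M), ext0 x k ^ 2 := by
  unfold casimirMean
  have h1 : ∑ k : Fin (numLevels twoS M), (levelJ twoS M k : ℝ) * ((levelJ twoS M k : ℝ) + 1) * x k ^ 2
      = ∑ k : Fin (numLevels twoS M), (fun j : ℕ => fK twoS M j * ext0 x j ^ 2) (k : ℕ) := by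
    apply Finset.sum_congr rfl; intro k _; simp [fK]
  have h2 : ∑ k : Fin (numLevels twoS M), x k ^ 2
      = ∑ k : Fin (numLevels twoS M), (fun j : ℕ => ext0 x j ^ 2) (k : ℕ) := by
    apply Finset.sum_congr rfl; intro k _; simp
  rw [h1, h2, ← Fin.sum_univ_eq_sum_range (fun j => fK twoS M j * ext0 x j ^ 2) (numLevels twoS M),
    ← Fin.sum_univ_eq_sum_range (fun j => ext0 x j ^ 2) (numLevels twoS M)]

/-! ## Level bookkeeping -/

/-- `jMin` has the parity of `2s`. [folklore] -/
theorem jMin_mod_two (twoS : ℕ) (M : ℤ) : jMin twoS M % 2 = twoS % 2 := by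
  unfold jMin; split_ifs with h <;> omega

/-- `|M| ≤ jMin`. [folklore] -/
theorem natAbs_le_jMin (twoS : ℕ) (M : ℤ) : M.natAbs ≤ jMin twoS M := by
  unfold jMin; split_ifs <;> omega

/-- `jMin ≤ |M| + 1`. [folklore] -/
theorem jMin_le_natAbs_succ (twoS : ℕ) (M : ℤ) : jMin twoS M ≤ M.natAbs + 1 := by
  unfold jMin; split_ifs <;> omega

/-- `jMin ≤ 2s` as soon as `|M| ≤ 2s`. [folklore] -/
theorem jMin_le (twoS : ℕ) {M : ℤ} (hM : M.natAbs ≤ twoS) : jMin twoS M ≤ twoS := by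
  unfold jMin; split_ifs with h <;> omega

/-- `numLevels ≥ 1`. [folklore] -/
theorem numLevels_pos (twoS : ℕ) (M : ℤ) : 0 < numLevels twoS M := Nat.succ_pos _

/-- **the top level is `J = 2s`:** `lev (numLevels − 1) = twoS` (for `|M| ≤ 2s`). [folklore] -/
theorem lev_top (twoS : ℕ) {M : ℤ} (hM : M.natAbs ≤ twoS) : lev twoS M (numLevels twoS M - 1) = twoS := by
  have h1 := jMin_mod_two twoS M
  have h2 := jMin_le twoS hM
  unfold lev numLevels
  omega

/-- every level is `≤ 2s` (for `|M| ≤ 2s`). [folklore] -/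
theorem lev_le (twoS : ℕ) {M : ℤ} (hM : M.natAbs ≤ twoS) {k : ℕ} (hk : k < numLevels twoS M) :
    lev twoS M k ≤ twoS := by
  have h1 := jMin_mod_two twoS M
  have h2 := jMin_le twoS hM
  unfold lev; unfold numLevels at hk
  omega

/-- non-top levels satisfy `J_k + 2 ≤ 2s`. [folklore] -/
theorem lev_add_two_le (twoS : ℕ) {M : ℤ} (hM : M.natAbs ≤ twoS) {k : ℕ} (hk : k + 1 < numLevels twoS M) :
    lev twoS M k + 2 ≤ twoS := by
  have h1 := jMin_mod_two twoS M
  have h2 := jMin_le twoS hM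
  unfold lev; unfold numLevels at hk
  omega

/-- `|M| ≤ J_k`. [folklore] -/
theorem natAbs_le_lev (twoS : ℕ) (M : ℤ) (k : ℕ) : M.natAbs ≤ lev twoS M k := by
  have := natAbs_le_jMin twoS M; unfold lev; omega

/-- `lev` is strictly increasing. [folklore] -/
theorem lev_lt_lev (twoS : ℕ) (M : ℤ) {k l : ℕ} (h : k < l) : lev twoS M k < lev twoS M l := by
  unfold lev; omega

/-- the level function `J(J+1)` is non-decreasing along the block. [folklore] -/
theorem fK_mono (twoS : ℕ) (M : ℤ) {k l : ℕ} (h : k ≤ l) : fK twoS M k ≤ fK twoS M l := by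
  unfold fK
  have : (lev twoS M k : ℝ) ≤ lev twoS M l := by
    rcases h.lt_or_eq with h | h
    · exact_mod_cast (lev_lt_lev twoS M h).le
    · rw [h]
  have h0 : (0 : ℝ) ≤ lev twoS M k := Nat.cast_nonneg _
  nlinarith

/-- `J(J+1) ≤ 2s(2s+1)` on the block (for `|M| ≤ 2s`). [folklore] -/
theorem fK_le_top (twoS : ℕ) {M : ℤ} (hM : M.natAbs ≤ twoS) {k : ℕ} (hk : k < numLevels twoS M) :
    fK twoS M k ≤ (twoS : ℝ) * ((twoS : ℝ) + 1) := by
  unfold fK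
  have : (lev twoS M k : ℝ) ≤ twoS := by exact_mod_cast lev_le twoS hM hk
  have h0 : (0 : ℝ) ≤ lev twoS M k := Nat.cast_nonneg _
  nlinarith

/-! ## Positivity and monotonicity of the matrix data -/

/-- (F1, sign) `β_J² > 0` for `J < 2s`. [folklore] -/
theorem betaSq_pos {twoS J : ℕ} (hJ : J < twoS) : 0 < betaSq twoS J := by
  unfold betaSq
  apply div_pos
  · have : (J : ℝ) + 1 < (twoS : ℝ) + 1 := by exact_mod_cast Nat.succ_lt_succ hJ
    nlinarith [Nat.cast_nonneg (α := ℝ) J]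
  · positivity

/-- `β_J² ≥ 0` for `J ≤ 2s`. [folklore] -/
theorem betaSq_nonneg {twoS J : ℕ} (hJ : J ≤ twoS) : 0 ≤ betaSq twoS J := by
  unfold betaSq
  apply div_nonneg
  · have : (J : ℝ) + 1 ≤ (twoS : ℝ) + 1 := by exact_mod_cast Nat.succ_le_succ hJ
    nlinarith [Nat.cast_nonneg (α := ℝ) J]
  · positivity

/-- **(F1) `β_J²` is antitone in `J` on `J ≤ 2s`.** [folklore] -/
theorem betaSq_antitone {twoS J J' : ℕ} (hJJ' : J ≤ J') (hJ' : J' ≤ twoS) : betaSq twoS J' ≤ betaSq twoS J := by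
  unfold betaSq
  have hJr : (J : ℝ) ≤ J' := by exact_mod_cast hJJ'
  have hJ'r : (J' : ℝ) + 1 ≤ (twoS : ℝ) + 1 := by exact_mod_cast Nat.succ_le_succ hJ'
  have h0 : (0 : ℝ) ≤ J := Nat.cast_nonneg _
  rw [div_le_div_iff₀ (by positivity) (by positivity)]
  have hnum : 0 ≤ ((twoS : ℝ) + 1) ^ 2 - ((J' : ℝ) + 1) ^ 2 := by nlinarith
  have hnum' : ((twoS : ℝ) + 1) ^ 2 - ((J' : ℝ) + 1) ^ 2 ≤ ((twoS : ℝ) + 1) ^ 2 - ((J : ℝ) + 1) ^ 2 := by nlinarith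
  have hden : (2 * (J : ℝ) + 1) * (2 * (J : ℝ) + 3) ≤ (2 * (J' : ℝ) + 1) * (2 * (J' : ℝ) + 3) := by nlinarith
  calc (((twoS : ℝ) + 1) ^ 2 - ((J' : ℝ) + 1) ^ 2) * ((2 * (J : ℝ) + 1) * (2 * (J : ℝ) + 3))
      ≤ (((twoS : ℝ) + 1) ^ 2 - ((J' : ℝ) + 1) ^ 2) * ((2 * (J' : ℝ) + 1) * (2 * (J' : ℝ) + 3)) :=
        mul_le_mul_of_nonneg_left hden hnum
    _ ≤ (((twoS : ℝ) + 1) ^ 2 - ((J : ℝ) + 1) ^ 2) * ((2 * (J' : ℝ) + 1) * (2 * (J' : ℝ) + 3)) :=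
        mul_le_mul_of_nonneg_right hnum' (by positivity)

/-- `b_J(M)² > 0` for `|M| ≤ J` and `J + 1 ≤ 2s`. [folklore] -/
theorem bSq_pos {twoS : ℕ} {M : ℤ} {J : ℕ} (hMJ : M.natAbs ≤ J) (hJ : J + 1 ≤ twoS) : 0 < bSq twoS M J := by
  unfold bSq
  rw [if_pos hJ]
  apply mul_pos _ (betaSq_pos (by omega))
  have h1 : |(M : ℝ)| ≤ J := by
    rw [← Int.cast_abs, ← Int.cast_natCast]
    exact_mod_cast (Int.abs_eq_natAbs M ▸ (by exact_mod_cast hMJ : (M.natAbs : ℤ) ≤ J))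
  have h2 : (M : ℝ) ^ 2 ≤ (J : ℝ) ^ 2 := by
    rw [← sq_abs]; exact pow_le_pow_left₀ (abs_nonneg _) h1 2
  nlinarith [Nat.cast_nonneg (α := ℝ) J]

/-- `b_J(M)² ≥ 0` for `|M| ≤ J + 1`. [folklore] -/
theorem bSq_nonneg {twoS : ℕ} {M : ℤ} {J : ℕ} (hMJ : M.natAbs ≤ J + 1) : 0 ≤ bSq twoS M J := by
  unfold bSq
  split_ifs with hJ
  · apply mul_nonneg _ (betaSq_nonneg (by omega))
    have h1 : |(M : ℝ)| ≤ (J : ℝ) + 1 := by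
      rw [← Int.cast_abs]
      have : (|M| : ℤ) ≤ (J : ℤ) + 1 := by rw [Int.abs_eq_natAbs]; exact_mod_cast hMJ
      exact_mod_cast this
    have h2 : (M : ℝ) ^ 2 ≤ ((J : ℝ) + 1) ^ 2 := by
      rw [← sq_abs]; exact pow_le_pow_left₀ (abs_nonneg _) h1 2
    linarith
  · exact le_rfl

/-- **positive couplings:** `c_k(M) > 0` on every non-top row (`η > 0`, `|M| ≤ 2s`). [folklore] -/
theorem cK_pos {twoS : ℕ} {M : ℤ} (hM : M.natAbs ≤ twoS) {η : ℝ} (hη : 0 < η) {k : ℕ}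
    (hk : k + 1 < numLevels twoS M) : 0 < cK twoS M η k := by
  unfold cK
  have h2 := lev_add_two_le twoS hM hk
  have hk1 := natAbs_le_lev twoS M k
  apply mul_pos (by positivity)
  apply Real.sqrt_pos.mpr
  exact mul_pos (bSq_pos hk1 (by omega)) (bSq_pos (by omega) (by omega))

/-- `c_k(M) ≥ 0` always for `η ≥ 0`. [folklore] -/
theorem cK_nonneg (twoS : ℕ) (M : ℤ) {η : ℝ} (hη : 0 ≤ η) (k : ℕ) : 0 ≤ cK twoS M η k := by
  unfold cK; exact mul_nonneg (by positivity) (Real.sqrt_nonneg _)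

/-- **(F2)/(F4, squared) `b_J(M)²` is antitone in `|M|`** (at fixed `J`). [folklore] -/
theorem bSq_antitone_abs {twoS : ℕ} {M M' : ℤ} (h : |M| ≤ |M'|) (J : ℕ) : bSq twoS M' J ≤ bSq twoS M J := by
  unfold bSq
  split_ifs with hJ
  · have hb := betaSq_nonneg (twoS := twoS) (J := J) (by omega)
    have h1 : (M : ℝ) ^ 2 ≤ (M' : ℝ) ^ 2 := by
      have : |(M : ℝ)| ≤ |(M' : ℝ)| := by
        rw [← Int.cast_abs, ← Int.cast_abs]; exact_mod_cast h
      rw [← sq_abs, ← sq_abs (M' : ℝ)]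
      exact pow_le_pow_left₀ (abs_nonneg _) this 2
    nlinarith
  · exact le_rfl

end Summit.HubbardSuperconductivity.HubbardSuperconductivity.Theorems.AnisotropyChord.Knn
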